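import Mathlib
import Literature.AlgebraicGeometry.Resolution.ProjectiveModelsDomination
import Literature.AlgebraicGeometry.Motives.ProjectiveSpaceFieldPoints
import Literature.AlgebraicGeometry.Motives.Varieties
import Literature.AlgebraicGeometry.Resolution.ProjectiveSpaceRegular

/-!
# TropicalLinks / SchonResolves — the monomial projective closure resolves

Route `ResolutionOfSingularities/TropicalLinks`, crux `SchonResolves` (stmt 17234), line
`zariski-toric-closure`, stub `stub_closureResolves` (Steps E+G of Tevelev's "schön ⇒ resolution",
characteristic-free, no toric vocabulary). For a projective model `MX` of `K/k`,
`ev' : k[ℤⁿ] → K`, lattice points `A : Fin (N+1) → ℤⁿ` that are rational convex combinations of the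
vertices `Vert` (D2), and regular vertex chart rings `D_a = k[ev'(x^{A b − A a}) : b] ⊆ K` with
`k`-morphisms `Spec D_a → MX` through which the `K`-point factors, `MX` has a resolution:
* the `K`-point `rl = ([ev'(x^{A b})]_b, gen)` of `Q = ℙᴺ ×ₖ MX` has a closure model `Z`
  (`ProjModel.ofClosure`) dominating `MX`, so it suffices that `Z` is regular
  (`ProjModel.Hom.hasResolution`);
* over `Q_a = D₊(x_a) ×ₖ MX` the graph `(Spec D_a ↪ D₊(x_a), g_a)` is a closed immersion (first
  component `Spec` of the surjection `k[x]_{(x_a)} → D_a`, and `Q_a → D₊(x_a)` separated)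
  through which `rl` factors via the dominant `Spec K → Spec D_a`, so `Z ∩ Q_a ≅ Spec D_a`
  (a dominant closed immersion into the reduced `Z ∩ Q_a` is an isomorphism) is regular;
* these opens cover `Z`: by (D2) the homogeneous relation `x_b^m = ∏_a x_a^{c_a}` (`Σ c = m > 0`,
  `c` supported on `Vert`) holds at the `K`-point, hence on its closure `Z`.

Standard material (Zariski–Samuel II, Ch. VI §17; Görtz–Wedhorn I, proof of Thm. 13.100,
Step 3; Hartshorne II Prop. 2.5); no new definitions.
-/

-- single-problem summit: the doubled namespace component `ResolutionOfSingularities` is forced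
set_option linter.dupNamespace false

namespace Summit.ResolutionOfSingularities.ResolutionOfSingularities.Theorems

open CategoryTheory CategoryTheory.Limits AlgebraicGeometry TopologicalSpace IsLocalRing
  MonoidalCategory CartesianMonoidalCategory HomogeneousLocalization MvPolynomial
open Literature.AlgebraicGeometry.Resolution Literature.AlgebraicGeometry.Motives
open Literature.AlgebraicGeometry.Motives.ProjectiveSpace

-- Mathlib's non-instance grading of `k[x₀,…,x_N]` and the tree's `k`-algebra structure on its
-- homogeneous localisations (the local instances under which `ProjectiveSpace.awayEval` is stated).
attribute [local instance] MvPolynomial.gradedAlgebra ProjBaseChange.algebraBase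

set_option hygiene false in
local notation "𝒜" => MvPolynomial.homogeneousSubmodule (Fin (N + 1)) k

universe u

/-! ## Generic scheme-theoretic lemmas -/

/-- A morphism `Γ' : T → Y` whose composite with a separated `f : Y → B` is a closed immersion
`c : T → W` followed by an open immersion `o : W → B` co-restricts to a closed immersion into
the open `f⁻¹(o(W))`. [folklore] -/
theorem schonResolves_exists_closedImmersion_lift {T Y B W : Scheme.{u}} (Γ' : T ⟶ Y)
    (f : Y ⟶ B) [IsSeparated f] (c : T ⟶ W) [IsClosedImmersion c] (o : W ⟶ B)
    [IsOpenImmersion o] (h : Γ' ≫ f = c ≫ o) :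
    ∃ Γ : T ⟶ ↑(f ⁻¹ᵁ o.opensRange),
      IsClosedImmersion Γ ∧ Γ ≫ (f ⁻¹ᵁ o.opensRange).ι = Γ' := by
  have hr : Set.range Γ' ⊆ Set.range (f ⁻¹ᵁ o.opensRange).ι := by
    rw [Scheme.Opens.range_ι]
    rintro _ ⟨x, rfl⟩
    change f (Γ' x) ∈ o.opensRange
    exact ⟨c x, by rw [← Scheme.Hom.comp_apply, ← h, Scheme.Hom.comp_apply]⟩
  refine ⟨IsOpenImmersion.lift _ Γ' hr, ?_, IsOpenImmersion.lift_fac _ _ _⟩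
  let e := IsOpenImmersion.isoOfRangeEq o o.opensRange.ι (by rw [Scheme.Opens.range_ι]; rfl)
  have hcomp : IsOpenImmersion.lift _ Γ' hr ≫ (f ∣_ o.opensRange) = c ≫ e.hom := by
    rw [← cancel_mono o.opensRange.ι, Category.assoc, morphismRestrict_ι,
      IsOpenImmersion.lift_fac_assoc, Category.assoc, IsOpenImmersion.isoOfRangeEq_hom_fac, h]
  haveI : IsClosedImmersion (IsOpenImmersion.lift _ Γ' hr ≫ (f ∣_ o.opensRange)) := by
    rw [hcomp]; infer_instance
  exact IsClosedImmersion.of_comp _ (f ∣_ o.opensRange)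

/-- **The closure of a `K`-point over a chart.** Let `Z` be a projective model of `K/k` embedded
by the closed immersion `ι` in `Y`, `U ⊆ Y` open, and `Γ : T → U` a closed immersion from a
reduced scheme through which the `K`-point of `Z` factors via a dominant `σ : Spec K → T`. Then
`T` is an open subscheme of `Z` containing `Z ∩ U`: `Γ` lifts to a dominant closed immersion into
the reduced `Z ∩ U`, i.e. an isomorphism. [folklore] -/
theorem schonResolves_exists_isOpenImmersion_chart {k K : Type u} [Field k] [Field K]
    [Algebra k K] (Z : ProjModel k K) {Y T : Scheme.{u}} (ι : Z.X ⟶ Y) [IsClosedImmersion ι]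
    (U : Y.Opens) (Γ : T ⟶ (U : Scheme.{u})) [IsClosedImmersion Γ] [IsReduced T]
    (σ : Spec (CommRingCat.of K) ⟶ T) [IsDominant σ] (h : σ ≫ Γ ≫ U.ι = Z.gen ≫ ι) :
    ∃ j : T ⟶ Z.X, IsOpenImmersion j ∧ ∀ q : Z.X, ι q ∈ U → q ∈ Set.range j := by
  -- `Γ(T) ⊆ Z`
  have hrange : Set.range (Γ ≫ U.ι) ⊆ Set.range ι := by
    rintro _ ⟨x, rfl⟩
    have hx : x ∈ closure (Set.range σ) := by
      rw [(IsDominant.denseRange (f := σ)).closure_range]; trivial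
    have h1 := map_mem_closure (Γ ≫ U.ι).continuous hx (t := Set.range ι) (by
      rintro _ ⟨p, rfl⟩
      exact ⟨Z.gen p, by rw [← Scheme.Hom.comp_apply, ← h, Scheme.Hom.comp_apply]⟩)
    rwa [ι.isClosedEmbedding.isClosed_range.closure_eq] at h1
  let j := IsClosedImmersion.liftOfRange ι (Γ ≫ U.ι) hrange
  have hj : j ≫ ι = Γ ≫ U.ι := IsClosedImmersion.liftOfRange_fac _ _ _
  -- into the open `ι⁻¹(U)`
  have hjV : Set.range j ⊆ Set.range (ι ⁻¹ᵁ U).ι := by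
    rw [Scheme.Opens.range_ι]
    rintro _ ⟨x, rfl⟩
    change ι (j x) ∈ U
    rw [← Scheme.Hom.comp_apply, hj, Scheme.Hom.comp_apply]
    exact (Γ x).2
  let j' := IsOpenImmersion.lift (ι ⁻¹ᵁ U).ι j hjV
  have hj' : j' ≫ (ι ⁻¹ᵁ U).ι = j := IsOpenImmersion.lift_fac _ _ _
  have hj'c : j' ≫ (ι ∣_ U) = Γ := by
    rw [← cancel_mono U.ι, Category.assoc, morphismRestrict_ι, ← Category.assoc, hj', hj]
  haveI : IsClosedImmersion j' := by
    have : IsClosedImmersion (j' ≫ (ι ∣_ U)) := by rw [hj'c]; infer_instance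
    exact IsClosedImmersion.of_comp j' (ι ∣_ U)
  -- the `K`-point lands in `ι⁻¹(U)` and is its generic point
  have hsV : Set.range Z.gen ⊆ Set.range (ι ⁻¹ᵁ U).ι := by
    rw [Scheme.Opens.range_ι]
    rintro _ ⟨p, rfl⟩
    change ι (Z.gen p) ∈ U
    rw [← Scheme.Hom.comp_apply, ← h, Scheme.Hom.comp_apply, Scheme.Hom.comp_apply]
    exact (Γ (σ p)).2
  let sV := IsOpenImmersion.lift (ι ⁻¹ᵁ U).ι Z.gen hsV
  have hsV' : sV ≫ (ι ⁻¹ᵁ U).ι = Z.gen := IsOpenImmersion.lift_fac _ _ _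
  haveI : Nonempty (↑(ι ⁻¹ᵁ U) : Scheme.{u}) := ⟨sV (closedPoint K)⟩
  haveI : IsIntegral (↑(ι ⁻¹ᵁ U) : Scheme.{u}) :=
    isIntegral_of_isOpenImmersion (ι ⁻¹ᵁ U).ι
  have hη : sV (closedPoint K) = _root_.genericPoint _ :=
    ProjModel.eq_genericPoint_of_comp_ι (M' := Z) (ι ⁻¹ᵁ U) sV hsV'
  have hσj' : σ ≫ j' = sV := by
    rw [← cancel_mono (ι ⁻¹ᵁ U).ι, Category.assoc, hj', hsV', ← cancel_mono ι,
      Category.assoc, hj]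
    exact h
  -- `j'` is a surjective closed immersion into a reduced scheme, hence an isomorphism
  haveI : Surjective j' := ⟨by
    have hcl : IsClosed (Set.range j') := j'.isClosedEmbedding.isClosed_range
    have hg : closure {sV (closedPoint K)} = (Set.univ : Set ↑(ι ⁻¹ᵁ U)) := by
      rw [hη]; exact genericPoint_closure _
    have hdense : closure (Set.range j') = Set.univ := by
      rw [← Set.univ_subset_iff, ← hg]
      refine closure_mono (Set.singleton_subset_iff.mpr ⟨σ (closedPoint K), ?_⟩)
      rw [← Scheme.Hom.comp_apply, hσj']
    rw [← Set.range_eq_univ, ← hcl.closure_eq, hdense]⟩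
  haveI : IsIso j' := isIso_of_isClosedImmersion_of_surjective j'
  refine ⟨j, ?_, fun q hq => ?_⟩
  · rw [← hj']; infer_instance
  · have hq' : q ∈ Set.range (ι ⁻¹ᵁ U).ι := by rw [Scheme.Opens.range_ι]; exact hq
    obtain ⟨v, rfl⟩ := hq'
    obtain ⟨t, rfl⟩ := (inferInstance : Surjective j').surj v
    exact ⟨t, by rw [← hj', Scheme.Hom.comp_apply]⟩

/-- Points of a projective model embedded in `Y` lie in every closed subset of `Y` containing
the image of its `K`-point (the `K`-point is the generic point). [folklore] -/
theorem schonResolves_embedding_mem_of_isClosed {k K : Type u} [Field k] [Field K] [Algebra k K]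
    (Z : ProjModel k K) {Y : Scheme.{u}} (ι : Z.X ⟶ Y) {C : Set Y} (hC : IsClosed C)
    (h0 : ι (Z.gen (closedPoint K)) ∈ C) (q : Z.X) : ι q ∈ C := by
  have hq : q ∈ closure ({genericPoint Z.X} : Set Z.X) := by
    rw [genericPoint_closure]; trivial
  have h1 := map_mem_closure ι.continuous hq (t := C) (fun x hx => by
    rw [Set.mem_singleton_iff.mp hx, ← Z.genericPt_eq]; exact h0)
  rwa [hC.closure_eq] at h1

/-! ## Algebraic lemmas -/

/-- `mlt • A b = Σ c_a • A a` gives `ev'(x^{A b})^{mlt} = ∏ ev'(x^{A a})^{c_a}`. [folklore] -/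
theorem schonResolves_pow_eq_prod_pow {k K : Type u} [Field k] [Field K] [Algebra k K]
    {n N : ℕ} (ev' : AddMonoidAlgebra k (Fin n → ℤ) →ₐ[k] K) {A : Fin (N + 1) → (Fin n → ℤ)}
    {b : Fin (N + 1)} {mlt : ℕ} {c : Fin (N + 1) → ℕ} (h : mlt • A b = ∑ a, c a • A a) :
    ev' (AddMonoidAlgebra.single (A b) 1) ^ mlt =
      ∏ a, ev' (AddMonoidAlgebra.single (A a) 1) ^ c a := by
  rw [← map_pow, AddMonoidAlgebra.single_pow, one_pow, h]
  simp_rw [← map_pow, AddMonoidAlgebra.single_pow, one_pow]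
  rw [← map_prod, AddMonoidAlgebra.prod_single, Finset.prod_const_one]

/-- If `x_b ∉ I` and `x_b^{mlt} - ∏ x_a^{c_a} ∈ I` for a prime `I` with `Σ c = mlt > 0`, then some
`x_a` with `c_a ≠ 0` is not in `I`. [folklore] -/
theorem schonResolves_exists_X_not_mem {k : Type u} [Field k] {N : ℕ}
    (I : Ideal (MvPolynomial (Fin (N + 1)) k)) [I.IsPrime] {b : Fin (N + 1)} {mlt : ℕ}
    {c : Fin (N + 1) → ℕ} (hmlt : 0 < mlt) (hsum : ∑ a, c a = mlt)
    (hb : (X b : MvPolynomial (Fin (N + 1)) k) ∉ I)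
    (hG : (X b ^ mlt - ∏ a, X a ^ c a : MvPolynomial (Fin (N + 1)) k) ∈ I) :
    ∃ a, c a ≠ 0 ∧ (X a : MvPolynomial (Fin (N + 1)) k) ∉ I := by
  by_contra! hcon
  obtain ⟨a₀, -, ha₀⟩ : ∃ a ∈ Finset.univ, c a ≠ 0 :=
    Finset.exists_ne_zero_of_sum_ne_zero (by rw [hsum]; exact hmlt.ne')
  have hprod : (∏ a, X a ^ c a : MvPolynomial (Fin (N + 1)) k) ∈ I := by
    rw [← Finset.mul_prod_erase Finset.univ _ (Finset.mem_univ a₀)]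
    exact I.mul_mem_right _ (I.pow_mem_of_mem (hcon a₀ ha₀) _ (Nat.pos_of_ne_zero ha₀))
  have hpow : (X b : MvPolynomial (Fin (N + 1)) k) ^ mlt ∈ I := by
    simpa using I.add_mem hG hprod
  exact hb (‹I.IsPrime›.mem_of_pow_mem _ hpow)

/-- **The chart ring as a quotient of `k[x]_{(x_a)}`.** For `z_b = ev'(x^{A b})` (units) the
evaluation `k[x₀,…,x_N]_{(x_a)} → K`, `g/x_a^m ↦ g(z)/z_a^m`, has image the subalgebra `D`
generated by the `z_b/z_a = ev'(x^{A b − A a})`, whence a surjection `k[x]_{(x_a)} → D` lifting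
it. [folklore] -/
theorem schonResolves_exists_awayChartHom {k K : Type u} [Field k] [Field K] [Algebra k K]
    {n N : ℕ} (ev' : AddMonoidAlgebra k (Fin n → ℤ) →ₐ[k] K) (A : Fin (N + 1) → (Fin n → ℤ))
    (a : Fin (N + 1)) (z : Fin (N + 1) → K) (hz : ∀ b, z b = ev' (.single (A b) 1))
    (hza : aeval z (X a : MvPolynomial (Fin (N + 1)) k) ≠ 0) (D : Subalgebra k K)
    (hD : Algebra.adjoin k (Set.range fun b => ev' (.single (A b - A a) (1 : k))) = D) :
    ∃ ψ : Away 𝒜 (X a : MvPolynomial (Fin (N + 1)) k) →ₐ[k] D, Function.Surjective ψ ∧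
      D.val.comp ψ = awayEval z hza := by
  subst hD
  have hza' : z a ≠ 0 := by rwa [aeval_X] at hza
  have hzw : ∀ b, z b = z a * ev' (AddMonoidAlgebra.single (A b - A a) (1 : k)) := by
    intro b
    rw [hz, hz, ← map_mul, AddMonoidAlgebra.single_mul_single, one_mul, add_sub_cancel]
  have hrange : (awayEval z hza).range =
      Algebra.adjoin k (Set.range fun b => ev' (.single (A b - A a) (1 : k))) := by
    apply le_antisymm
    · rintro _ ⟨q, rfl⟩
      obtain ⟨m, g, hg, rfl⟩ := Away.mk_surjective 𝒜 (X_mem a) q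
      have hev : aeval z g = z a ^ m *
          aeval (fun b => ev' (AddMonoidAlgebra.single (A b - A a) (1 : k))) g := by
        conv_lhs => rw [(funext hzw : z = _)]
        simpa using isHomogeneous_aeval_const_mul ((mem_homogeneousSubmodule _ g).mp hg)
          (z a) (fun b => ev' (AddMonoidAlgebra.single (A b - A a) (1 : k)))
      change awayEval z hza (Away.mk 𝒜 (X_mem a) m g hg) ∈ _
      rw [awayEval_mk _ _ (X_mem a) g hg, aeval_X, hev,
        mul_div_cancel_left₀ _ (pow_ne_zero m hza'), Algebra.adjoin_range_eq_range_aeval]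
      exact ⟨g, rfl⟩
    · rw [Algebra.adjoin_le_iff]
      rintro _ ⟨b, rfl⟩
      refine ⟨Away.mk 𝒜 (X_mem a) 1 (X b) (by simpa using X_mem b), ?_⟩
      change awayEval z hza _ = _
      rw [awayEval_mk _ _ (X_mem a), pow_one, aeval_X, aeval_X, hzw b,
        mul_div_cancel_left₀ _ hza']
  refine ⟨(Subalgebra.equivOfEq _ _ hrange).toAlgHom.comp (awayEval z hza).rangeRestrict,
    (Subalgebra.equivOfEq _ _ hrange).surjective.comp (AlgHom.rangeRestrict_surjective _), ?_⟩
  ext q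
  rfl

/-! ## The registered stub -/

/-- **Stub E+G (the closure resolves).** Let `MX` be a projective model of `K/k`,
`ev' : k[ℤ^n] → K`, `A` an injective family of lattice points whose members are rational convex
combinations of the vertices `Vert` (D2). If for every vertex `a` the chart ring
`D_a = k[ev'(x^{A b − A a}) : b] ⊆ K` is regular at every prime and carries a `k`-morphism
`Spec D_a → MX.X` through which the `K`-point of `MX` factors, then `MX.X` has a resolution:
the closure model `Z` of the `K`-point `([ev'(x^{A b})]_b, gen)` in `ℙᴺ ×ₖ MX` dominates `MX`,
`Z ∩ (D₊(z_a) × MX) ≅ Spec D_a` is regular, and these opens cover `Z` by (D2). -/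
theorem stub_closureResolves :
    ∀ (k : Type) [Field k] (K : Type) [Field K] [Algebra k K] (MX : Literature.AlgebraicGeometry.Resolution.ProjModel k K) (n N : ℕ) (ev' : AddMonoidAlgebra k (Fin n → ℤ) →ₐ[k] K) (A : Fin (N + 1) → (Fin n → ℤ)) (Vert : Finset (Fin (N + 1))), Function.Injective A → (∀ b : Fin (N + 1), ∃ (mlt : ℕ) (c : Fin (N + 1) → ℕ), 0 < mlt ∧ (∀ a, c a ≠ 0 → a ∈ Vert) ∧ ∑ a, c a = mlt ∧ mlt • A b = ∑ a, c a • A a) → (∀ a ∈ Vert, ∃ g : AlgebraicGeometry.Spec (CommRingCat.of ↥(Algebra.adjoin k (Set.range fun b : Fin (N + 1) => ev' (AddMonoidAlgebra.single (A b - A a) (1 : k))))) ⟶ MX.X, g ≫ MX.π = AlgebraicGeometry.Spec.map (CommRingCat.ofHom (algebraMap k ↥(Algebra.adjoin k (Set.range fun b : Fin (N + 1) => ev' (AddMonoidAlgebra.single (A b - A a) (1 : k)))))) ∧ AlgebraicGeometry.Spec.map (CommRingCat.ofHom (Algebra.adjoin k (Set.range fun b : Fin (N + 1) => ev' (AddMonoidAlgebra.single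 (A b - A a) (1 : k)))).val.toRingHom) ≫ g = MX.gen) → (∀ a ∈ Vert, ∀ (P : Ideal ↥(Algebra.adjoin k (Set.range fun b : Fin (N + 1) => ev' (AddMonoidAlgebra.single (A b - A a) (1 : k))))) [P.IsPrime], IsRegularLocalRing (Localization.AtPrime P)) → Literature.AlgebraicGeometry.Resolution.Scheme.HasResolution MX.X := by
  intro k _ K _ _ MX n N ev' A Vert _ hD2 hcharts hreg
  classical
  -- the monomials `ev'(x^v)` are units, hence non-zero
  have hzne : ∀ v : Fin n → ℤ, ev' (AddMonoidAlgebra.single v (1 : k)) ≠ 0 := by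
    intro v hv
    have h1 : ev' (AddMonoidAlgebra.single v (1 : k)) *
        ev' (AddMonoidAlgebra.single (-v) (1 : k)) = 1 := by
      rw [← map_mul, AddMonoidAlgebra.single_mul_single, add_neg_cancel, mul_one,
        ← AddMonoidAlgebra.one_def, map_one]
    rw [hv, zero_mul] at h1
    exact zero_ne_one h1
  -- homogeneous coordinates of the `K`-point of `ℙᴺ`
  obtain ⟨z, hz⟩ : ∃ z : Fin (N + 1) → K, ∀ b, z b = ev' (.single (A b) 1) := ⟨_, fun _ => rfl⟩
  have hz0 : z ≠ 0 := fun h => hzne (A 0) (by rw [← hz, h]; rfl)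
  -- the ambient `Q = ℙᴺ ×ₖ MX`, its projections and the `K`-point `rl = ([z], gen)`
  let Q : SchemeOver k := projectiveSpace N k ⊗ MX.toOver
  have hQ : IsProjectiveOver Q :=
    (isSmoothProjective_projectiveSpace_holds k N).isProjectiveOver.tensor MX.isProjectiveOver
  let pK : specOver k K ⟶ projectiveSpace N k := pointOfVec k z hz0
  let gO : specOver k K ⟶ MX.toOver := Over.homMk MX.gen MX.gen_π
  let rl : Spec (CommRingCat.of K) ⟶ Q.left := (CartesianMonoidalCategory.lift pK gO).left
  let fst' : Q.left ⟶ (projectiveSpace N k).left :=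
    (CartesianMonoidalCategory.fst (projectiveSpace N k) MX.toOver).left
  let s : Q.left ⟶ MX.X := (CartesianMonoidalCategory.snd (projectiveSpace N k) MX.toOver).left
  have hs : s ≫ MX.π = Q.hom := Over.w (CartesianMonoidalCategory.snd _ MX.toOver)
  have hr : rl ≫ s = MX.gen := by
    change (CartesianMonoidalCategory.lift pK gO).left ≫
      (CartesianMonoidalCategory.snd (projectiveSpace N k) MX.toOver).left = _
    rw [← Over.comp_left, CartesianMonoidalCategory.lift_snd]
    rfl
  have hrf : rl ≫ fst' = pK.left := by
    change (CartesianMonoidalCategory.lift pK gO).left ≫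
      (CartesianMonoidalCategory.fst (projectiveSpace N k) MX.toOver).left = _
    rw [← Over.comp_left, CartesianMonoidalCategory.lift_fst]
  haveI : IsSeparated fst' := by
    haveI : IsProper Q.hom := hQ.isProper
    haveI : IsSeparated (fst' ≫ (projectiveSpace N k).hom) := by
      rw [show fst' ≫ (projectiveSpace N k).hom = Q.hom from
        Over.w (CartesianMonoidalCategory.fst (projectiveSpace N k) MX.toOver)]
      infer_instance
    exact IsSeparated.of_comp fst' (projectiveSpace N k).hom
  -- the closure model `Z` dominates `MX`; it remains to see that `Z` is regular
  let Z : ProjModel k K := ProjModel.ofClosure MX hQ rl s hs hr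
  refine (ProjModel.ofClosure.homOf MX hQ rl s hs hr MX s hs hr).hasResolution ?_
  apply Scheme.IsRegular.of_forall_exists_isOpenImmersion
  intro q
  obtain ⟨p, hp⟩ : ∃ p : Proj 𝒜, p = fst' (rl.imageι q) := ⟨_, rfl⟩
  -- (3) some vertex coordinate does not vanish at `q`
  obtain ⟨a, haV, ha⟩ : ∃ a ∈ Vert, p ∈ Proj.basicOpen 𝒜 (X a) := by
    obtain ⟨b, hb⟩ : ∃ b, p ∈ Proj.basicOpen 𝒜 (X b) := by
      obtain ⟨y, hy⟩ := (ProjectiveSpace.chartCover N k).covers p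
      refine ⟨(ProjectiveSpace.chartCover N k).idx p, ?_⟩
      rw [← Proj.opensRange_awayι 𝒜 _ (X_mem _) one_pos]
      exact ⟨y, hy⟩
    obtain ⟨mlt, c, hmlt, hcV, hsum, hrel⟩ := hD2 b
    have hGmem : (X b ^ mlt - ∏ a, X a ^ c a : MvPolynomial (Fin (N + 1)) k) ∈ 𝒜 mlt := by
      rw [mem_homogeneousSubmodule]
      refine IsHomogeneous.sub (by simpa using (isHomogeneous_X k b).pow mlt) ?_
      have := IsHomogeneous.prod Finset.univ (fun a => (X a : MvPolynomial (Fin (N + 1)) k) ^ c a)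
        c (fun a _ => by simpa using (isHomogeneous_X k a).pow (c a))
      rwa [hsum] at this
    -- the relation `x_b^{mlt} = ∏ x_a^{c_a}` holds at the `K`-point, hence on `Z`
    have hG : (X b ^ mlt - ∏ a, X a ^ c a : MvPolynomial (Fin (N + 1)) k) ∈
        p.asHomogeneousIdeal := by
      have key := schonResolves_embedding_mem_of_isClosed Z (rl.imageι ≫ fst')
        (C := ProjectiveSpectrum.zeroLocus 𝒜 {X b ^ mlt - ∏ a, X a ^ c a})
        (ProjectiveSpectrum.isClosed_zeroLocus 𝒜 _) ?_ q
      · have key' : p ∈ ProjectiveSpectrum.zeroLocus 𝒜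
            {(X b ^ mlt - ∏ a, X a ^ c a : MvPolynomial (Fin (N + 1)) k)} := by
          rw [hp]; exact key
        exact Set.singleton_subset_iff.mp ((ProjectiveSpectrum.mem_zeroLocus 𝒜 p _).mp key')
      · change fst' (rl.imageι (rl.toImage (closedPoint K))) ∈ _
        rw [← Scheme.Hom.comp_apply rl.imageι fst', ← Scheme.Hom.comp_apply rl.toImage,
          Scheme.Hom.toImage_imageι_assoc, hrf]
        refine (pt_pointOfVec_mem_zeroLocus_iff z hz0 hmlt hGmem).mpr ?_
        simp only [map_sub, map_pow, map_prod, aeval_X, hz, sub_eq_zero]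
        exact schonResolves_pow_eq_prod_pow ev' hrel
    haveI := p.isPrime
    obtain ⟨a, hca, ha⟩ := schonResolves_exists_X_not_mem p.asHomogeneousIdeal.toIdeal hmlt hsum
      ((Proj.mem_basicOpen 𝒜 _ _).mp hb) hG
    exact ⟨a, hcV a hca, (Proj.mem_basicOpen 𝒜 _ _).mpr ha⟩
  -- (2) the chart at the vertex `a`: `D = D_a`, `ψ : k[x]_{(x_a)} ↠ D`
  have hzaX : aeval z (X a : MvPolynomial (Fin (N + 1)) k) ≠ 0 := by
    rw [aeval_X, hz]; exact hzne _
  obtain ⟨g, hgπ, hgK⟩ := hcharts a haV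
  have hrg := hreg a haV
  generalize hD : Algebra.adjoin k (Set.range fun b => ev' (.single (A b - A a) (1 : k))) = D
    at g hgπ hgK hrg
  obtain ⟨ψ, hψs, hψv⟩ := schonResolves_exists_awayChartHom ev' A a z hz hzaX D hD
  -- the graph `Γt = (Spec D ↠ Spec k[x]_{(x_a)} ⊂ ℙᴺ, g) : Spec D → Q` over `k`
  let DO : SchemeOver k := specOver k D
  let cO' : DO ⟶ specOver k (Away 𝒜 (X a : MvPolynomial (Fin (N + 1)) k)) :=
    Over.homMk (Spec.map (CommRingCat.ofHom ψ.toRingHom)) (by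
      change Spec.map _ ≫ Spec.map _ = Spec.map _
      rw [← Spec.map_comp, ← CommRingCat.ofHom_comp, AlgHom.toRingHom_eq_coe,
        AlgHom.comp_algebraMap])
  let cO : DO ⟶ projectiveSpace N k := cO' ≫ awayChartι (X_mem a) one_pos
  let gaO : DO ⟶ MX.toOver := Over.homMk g hgπ
  let Γt : Spec (CommRingCat.of D) ⟶ Q.left := (CartesianMonoidalCategory.lift cO gaO).left
  have hΓf : Γt ≫ fst' = Spec.map (CommRingCat.ofHom ψ.toRingHom) ≫
      Proj.awayι 𝒜 (X a) (X_mem a) one_pos := by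
    change (CartesianMonoidalCategory.lift cO gaO).left ≫
      (CartesianMonoidalCategory.fst (projectiveSpace N k) MX.toOver).left = _
    rw [← Over.comp_left, CartesianMonoidalCategory.lift_fst]
    rfl
  have hcι : IsClosedImmersion (Spec.map (CommRingCat.ofHom ψ.toRingHom)) :=
    IsClosedImmersion.spec_of_surjective _ hψs
  have hoι : @IsOpenImmersion _ (projectiveSpace N k).left
      (Proj.awayι 𝒜 (X a) (X_mem a) one_pos) :=
    inferInstanceAs (IsOpenImmersion (Proj.awayι 𝒜 (X a) (X_mem a) one_pos))
  obtain ⟨Γ, hΓc, hΓ⟩ := @schonResolves_exists_closedImmersion_lift _ Q.left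
    (projectiveSpace N k).left (Spec (CommRingCat.of (Away 𝒜 (X a : MvPolynomial _ k))))
    Γt fst' _ (Spec.map (CommRingCat.ofHom ψ.toRingHom)) hcι
    (Proj.awayι 𝒜 (X a) (X_mem a) one_pos) hoι hΓf
  -- the `K`-point factors through the graph via the dominant `σ : Spec K → Spec D`
  let σ : Spec (CommRingCat.of K) ⟶ Spec (CommRingCat.of D) :=
    Spec.map (CommRingCat.ofHom D.val.toRingHom)
  have hσΓ : σ ≫ Γt = rl := by
    let σO : specOver k K ⟶ DO := Over.homMk σ (by
      change Spec.map _ ≫ Spec.map _ = Spec.map _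
      rw [← Spec.map_comp, ← CommRingCat.ofHom_comp, AlgHom.toRingHom_eq_coe,
        AlgHom.comp_algebraMap])
    have key : σO ≫ CartesianMonoidalCategory.lift cO gaO =
        CartesianMonoidalCategory.lift pK gO := by
      apply CartesianMonoidalCategory.hom_ext
      · rw [Category.assoc, CartesianMonoidalCategory.lift_fst,
          CartesianMonoidalCategory.lift_fst, show pK = chartPoint (X_mem a) one_pos z hzaX from
            pointOfVec_eq_chartPoint z hz0 (X_mem a) one_pos hzaX]
        ext : 1
        change σ ≫ Spec.map (CommRingCat.ofHom ψ.toRingHom) ≫ Proj.awayι 𝒜 (X a) _ _ =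
          Spec.map (CommRingCat.ofHom (awayEval z hzaX).toRingHom) ≫ Proj.awayι 𝒜 (X a) _ _
        rw [← Spec.map_comp_assoc, ← CommRingCat.ofHom_comp, ← hψv]
        rfl
      · rw [Category.assoc, CartesianMonoidalCategory.lift_snd,
          CartesianMonoidalCategory.lift_snd]
        ext : 1
        exact hgK
    change σ ≫ (CartesianMonoidalCategory.lift cO gaO).left =
      (CartesianMonoidalCategory.lift pK gO).left
    rw [← key, Over.comp_left]
    rfl
  have hσd : IsDominant σ := ⟨by
    have hk : RingHom.ker D.val.toRingHom = ⊥ :=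
      (RingHom.injective_iff_ker_eq_bot _).mp Subtype.val_injective
    exact ((PrimeSpectrum.denseRange_comap_iff_ker_le_nilRadical D.val.toRingHom).mpr
      (by rw [hk]; exact bot_le) : DenseRange (PrimeSpectrum.comap D.val.toRingHom))⟩
  have hZι : @IsClosedImmersion Z.X Q.left rl.imageι :=
    inferInstanceAs (IsClosedImmersion rl.imageι)
  obtain ⟨j, hj, hjq⟩ := @schonResolves_exists_isOpenImmersion_chart k K _ _ _ Z Q.left _
    rl.imageι hZι _ Γ hΓc _ σ hσd (by
      rw [hΓ, hσΓ]
      exact (Scheme.Hom.toImage_imageι rl).symm)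
  -- `Spec D` is regular and covers `q`
  haveI : IsNoetherianRing D :=
    isNoetherianRing_of_fg (Subalgebra.fg_def.2 ⟨_, Set.finite_range _, hD⟩)
  haveI : IsRegularRing D := isRegularRing_iff.mpr (fun P' _ => hrg P')
  refine ⟨_, j, hj, hjq q ?_, Scheme.isRegular_Spec _⟩
  change fst' (rl.imageι q) ∈ (Proj.awayι 𝒜 (X a) (X_mem a) one_pos).opensRange
  rw [Proj.opensRange_awayι, ← hp]
  exact ha

end Summit.ResolutionOfSingularities.ResolutionOfSingularities.Theorems
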